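import Literature.NumberTheory.GaloisRepresentations.RamificationGalois
import Mathlib.Algebra.Group.Action.Pointwise.Finset
import Mathlib.Algebra.BigOperators.Ring.Finset
import HarnessLib

/-!
# Hasse–Arf for cyclic groups, IV: the expansion of a norm `∏_{g ∈ G} (1 + g y)` over orbits of subsets
(Serre, *Local Fields*, Ch. V §2 formula (∗) and §3 Lemma 5, for an arbitrary finite group)

Fourth file of the series proving Serre's Prop. V.11 in the global Dedekind setting
(`HasseArfCyclicBasic.lean`).  Serre computes the norm of a principal unit in a cyclic extension
of prime degree by expanding `N(1 + x) = ∏_s (1 + xˢ) = Σ_u x^u` over the elements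
`u = s₁ + ⋯ + s_k` of `ℤ[G]` and "collecting together the `sⁱ u`" (Ch. V §3, Lemma 5).  For a finite
group `G` acting on a commutative ring `S` we record this bookkeeping in general:

* `Literature.NumberTheory.GaloisRepresentations.NormExpansion.prod_one_add_smul` —
  **`∏_{g ∈ G} (1 + g y) = 1 + Σ_{∅ ≠ A ⊆ G} y_A`**, `y_A = ∏_{g ∈ A} g y`;
* `…smul_prodSmul` — `k · y_A = y_{kA}`; `…prodSmul_eq_of_mem_stabilizer` — `y_A` is fixed by the
  stabilizer of `A` (left translation);
* `…sum_mem_of_orbitSum_mem` — if for every non-empty `A` the **orbit sum**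
  `Σ_{B ∈ G·A} y_B` lies in an ideal `I`, then `∏_g (1 + g y) - 1 ∈ I` (the subsets are partitioned
  into `G`-orbits);
* `…ord_prodSmul` — `v_𝔓(y_A) = |A| · v_𝔓(y)` at a prime fixed by `G` (Dedekind domain).

The arithmetic — which orbit sums lie in which power of `𝔓` — is the subject of the later files;
there the orbit sum of `A` with stabilizer `H` is the trace from the fixed field of `H`.

## References

* J.-P. Serre, *Local Fields*, GTM 67, Springer 1979: Ch. V §2 (formula (∗)), §3 Lemma 5,
  §6 (proof of Prop. 8). [SerreLocalFields1979]
-/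

noncomputable section

open scoped Pointwise

namespace Literature.NumberTheory.GaloisRepresentations

namespace NormExpansion

variable {G : Type*} [Group G] [Fintype G] [DecidableEq G] {S : Type*} [CommRing S]
  [MulSemiringAction G S]

omit [Fintype G] in
/-- **Translation of the partial products**: `k · ∏_{g ∈ A} g y = ∏_{g ∈ kA} g y`.
Ref: Serre, *Local Fields*, Ch. V §3, proof of Lemma 5 ("collecting together the `sⁱu`"). [folklore] -/
theorem smul_prodSmul (k : G) (A : Finset G) (y : S) :
    k • ∏ g ∈ A, g • y = ∏ g ∈ k • A, g • y := by
  rw [Finset.smul_prod', ← Finset.image_smul, Finset.prod_image]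
  · simp_rw [smul_smul, smul_eq_mul]
  · intro a _ b _ h
    exact mul_left_cancel (show k * a = k * b from h)

omit [Fintype G] in
/-- `y_A` is fixed by the stabilizer of `A` under left translation. [folklore] -/
theorem prodSmul_eq_of_mem_stabilizer {A : Finset G} {h : G} (hh : h ∈ MulAction.stabilizer G A)
    (y : S) : h • ∏ g ∈ A, g • y = ∏ g ∈ A, g • y := by
  rw [smul_prodSmul, MulAction.mem_stabilizer_iff.mp hh]

/-- **Expansion of the norm of a principal unit over the non-empty subsets**:
`∏_{g ∈ G} (1 + g y) = 1 + Σ_{∅ ≠ A ⊆ G} ∏_{g ∈ A} g y`.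
Ref: Serre, *Local Fields*, Ch. V §2, formula (∗) and §3, Lemma 5.
[cite: SerreLocalFields1979, Ch. V §3 Lemma 5] -/
theorem prod_one_add_smul (y : S) :
    ∏ g : G, (1 + g • y) = 1 + ∑ A ∈ (Finset.univ : Finset G).powerset.erase ∅, ∏ g ∈ A, g • y := by
  rw [Finset.prod_one_add, ← Finset.add_sum_erase _ _ (Finset.empty_mem_powerset _),
    Finset.prod_empty]

/-- The set of non-empty subsets is stable under translation. [folklore] -/
theorem smul_mem_powerset_erase_empty {A : Finset G}
    (hA : A ∈ (Finset.univ : Finset G).powerset.erase ∅) (k : G) :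
    k • A ∈ (Finset.univ : Finset G).powerset.erase ∅ := by
  rw [Finset.mem_erase, Finset.mem_powerset] at hA ⊢
  refine ⟨fun h => hA.1 ?_, Finset.subset_univ _⟩
  rwa [← Finset.card_eq_zero, Finset.card_smul_finset, Finset.card_eq_zero] at h

omit [MulSemiringAction G S] in
/-- **Partition into orbits.**  Let `s` be a translation-stable finite set of subsets of `G` and
`f : Finset G → S`.  If for every `A ∈ s` the *orbit sum* `Σ_{B ∈ G·A} f(B)` (over the finite set
`{k A | k ∈ G}`) lies in the ideal `I`, then `Σ_{A ∈ s} f(A) ∈ I`.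
Ref: Serre, *Local Fields*, Ch. V §3, proof of Lemma 5 (the terms `x^u` are grouped into the
`Tr(x^u)` over orbits `{sⁱ u}`). [folklore] -/
theorem sum_mem_of_orbitSum_mem (I : Ideal S) (f : Finset G → S) {s : Finset (Finset G)}
    (hs : ∀ A ∈ s, ∀ k : G, k • A ∈ s)
    (h : ∀ A ∈ s, ∑ B ∈ (Finset.univ : Finset G).image (· • A), f B ∈ I) :
    ∑ A ∈ s, f A ∈ I := by
  classical
  rw [Finset.sum_partition (MulAction.orbitRel G (Finset G))]
  refine Ideal.sum_mem _ fun c hc => ?_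
  obtain ⟨A, hA, rfl⟩ := Finset.mem_image.mp hc
  -- the class of `A` inside `s` is its orbit
  have hclass : (s.filter fun B => (⟦B⟧ : Quotient (MulAction.orbitRel G (Finset G))) = ⟦A⟧) =
      (Finset.univ : Finset G).image (· • A) := by
    ext B
    simp only [Finset.mem_filter, Finset.mem_image, Finset.mem_univ, true_and, Quotient.eq]
    constructor
    · rintro ⟨-, hB⟩
      obtain ⟨k, rfl⟩ := MulAction.orbitRel_apply.mp hB
      exact ⟨k, rfl⟩
    · rintro ⟨k, rfl⟩
      exact ⟨hs A hA k, MulAction.orbitRel_apply.mpr ⟨k, rfl⟩⟩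
  rw [hclass]
  exact h A hA

/-- **`∏_g (1 + g y) - 1` lies in `I` as soon as every orbit sum of the `y_A`, `A ≠ ∅`, does.**
Ref: Serre, *Local Fields*, Ch. V §3, Lemma 5 and §6, proof of Prop. 8. [folklore] -/
theorem prod_one_add_smul_sub_one_mem (I : Ideal S) (y : S)
    (h : ∀ A : Finset G, A.Nonempty →
      ∑ B ∈ (Finset.univ : Finset G).image (· • A), ∏ g ∈ B, g • y ∈ I) :
    ∏ g : G, (1 + g • y) - 1 ∈ I := by
  rw [prod_one_add_smul, add_sub_cancel_left]
  refine sum_mem_of_orbitSum_mem I _ (fun A hA k => smul_mem_powerset_erase_empty hA k)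
    fun A hA => h A ?_
  rw [Finset.mem_erase] at hA
  exact Finset.nonempty_iff_ne_empty.mpr hA.1

/-- The orbit sum is `G`-invariant: `k · Σ_{B ∈ G·A} y_B = Σ_{B ∈ G·A} y_B`. [folklore] -/
theorem smul_orbitSum (k : G) (A : Finset G) (y : S) :
    k • ∑ B ∈ (Finset.univ : Finset G).image (· • A), ∏ g ∈ B, g • y =
      ∑ B ∈ (Finset.univ : Finset G).image (· • A), ∏ g ∈ B, g • y := by
  rw [Finset.smul_sum]
  simp_rw [smul_prodSmul]
  -- reindex the orbit by `B ↦ k • B`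
  refine Finset.sum_nbij (fun B => k • B) (fun B hB => ?_) (fun B₁ _ B₂ _ h => smul_left_cancel k h)
    (fun B hB => ?_) (fun _ _ => rfl)
  · obtain ⟨l, -, rfl⟩ := Finset.mem_image.mp hB
    exact Finset.mem_image.mpr ⟨k * l, Finset.mem_univ _, (mul_smul k l A)⟩
  · obtain ⟨l, -, rfl⟩ := Finset.mem_image.mp (Finset.mem_coe.mp hB)
    exact ⟨(k⁻¹ * l) • A, Finset.mem_coe.mpr (Finset.mem_image.mpr ⟨k⁻¹ * l, Finset.mem_univ _, rfl⟩),
      by simp only [smul_smul, mul_inv_cancel_left]⟩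

/-- The orbit sum as a sum over the group: `|Stab(A)| · Σ_{B ∈ G·A} y_B = Σ_{k ∈ G} y_{kA}`
(each `B` in the orbit is `k A` for exactly `|Stab(A)|` values of `k`).  Not used for estimates
(the factor `|Stab(A)|` may vanish in `S`), but it identifies the orbit sum.
Ref: Serre, *Local Fields*, Ch. V §3, Lemma 5. [folklore] -/
theorem card_stabilizer_smul_orbitSum (A : Finset G) (y : S) :
    Fintype.card (MulAction.stabilizer G A) •
        ∑ B ∈ (Finset.univ : Finset G).image (· • A), ∏ g ∈ B, g • y =
      ∑ k : G, ∏ g ∈ k • A, g • y := by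
  classical
  rw [Finset.sum_comp (fun B : Finset G => ∏ g ∈ B, g • y) (fun k : G => k • A), Finset.smul_sum]
  refine Finset.sum_congr rfl fun B hB => ?_
  obtain ⟨k, -, rfl⟩ := Finset.mem_image.mp hB
  congr 1
  -- the fibre over `k A` is the coset `k · Stab(A)`
  rw [← Fintype.card_coe]
  refine Fintype.card_congr ?_
  refine Equiv.subtypeEquiv (Equiv.mulLeft k) fun l => ?_
  simp only [Finset.mem_filter, Finset.mem_univ, true_and, Equiv.coe_mulLeft,
    MulAction.mem_stabilizer_iff, mul_smul]
  constructor
  · intro h; rw [h]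
  · intro h; exact (smul_left_cancel k h.symm).symm

end NormExpansion

/-! ### The order of `y_A` at a prime fixed by the group -/

section Order

variable {G : Type*} [Group G] {B : Type*} [CommRing B] [IsDedekindDomain B]
  [MulSemiringAction G B] (P : Ideal B) [P.IsPrime]

/-- **`v_𝔓(∏_{g ∈ A} g y) = |A| · v_𝔓(y)`** when every `g` fixes `𝔓`.
Ref: Serre, *Local Fields*, Ch. V §3, proof of Prop. 5 ("as `n(u) ≥ 2`, we have `x^u ∈ 𝔭_L^{2n}`").
[cite: SerreLocalFields1979, Ch. V §3 Lemma 5] -/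
theorem ord_prodSmul (hP : P ≠ ⊥) (hstab : ∀ g : G, g • P = P) (A : Finset G) (y : B) :
    ord P (∏ g ∈ A, g • y) = A.card * ord P y := by
  rw [ord_prod P hP, Finset.sum_congr rfl fun g _ => ord_smul P (hstab g) y, Finset.sum_const,
    nsmul_eq_mul]

/-- `y ∈ 𝔓ᵐ ⇒ ∏_{g ∈ A} g y ∈ 𝔓^{|A| m}` (every `g` fixing `𝔓`). [folklore] -/
theorem prodSmul_mem_pow (hP : P ≠ ⊥) (hstab : ∀ g : G, g • P = P) (A : Finset G) {y : B} {m : ℕ}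
    (hy : y ∈ P ^ m) : ∏ g ∈ A, g • y ∈ P ^ (A.card * m) := by
  rw [mem_pow_iff_le_ord, ord_prodSmul P hP hstab, Nat.cast_mul]
  rw [mem_pow_iff_le_ord] at hy
  exact mul_le_mul' le_rfl hy

end Order

end Literature.NumberTheory.GaloisRepresentations

end
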